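import Literature.Probability.RandomPlanarGeometry.SAWCountMonotoneRange
import Literature.Probability.RandomPlanarGeometry.SAWCountMonotoneCutFreeEleven
import HarnessLib

/-!
# Monotonicity `cₙ ≤ cₙ₊₁` (O'Brien 1990): the proven range, extended to `n ≤ 12` in every dimension

Update of `SAWCountMonotoneRange.lean` (`count_le_count_succ_of_range`: `n + 2 ≤ 6d`, or `n ≤ 10`,
or `n` even with `n + 6 ≤ 8d`; `count_mono_of_le`: `cₘ ≤ cₙ` for `m ≤ n ≤ max (6d, 12) - 1`) by the
square-lattice lengths `n = 11, 12` of `SAWCountMonotoneCutFreeEleven.lean` /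
`SAWCountMonotoneCutFreeBox.lean` (cut-edge doubling; `count_two_le_count_succ_of_le_twelve`):

* `count_le_count_succ_of_le_twelve` : **`cₙ ≤ cₙ₊₁` for every `n ≤ 12` on `ℤ^d`, every `d ≥ 1`**
  (`d = 1`: `count_one_le_count_one_succ`; `d = 2`: cut-edge doubling; `d ≥ 3`: `n + 2 ≤ 6d`);
* `count_le_count_succ_of_range_twelve` : the range `n + 2 ≤ 6d ∨ n ≤ 12 ∨ (Even n ∧ n + 6 ≤ 8d)`;
* `count_mono_of_le_fourteen`, `monotoneOn_count_fourteen` : `cₘ ≤ cₙ` for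
  `m ≤ n ≤ max (6d, 14) - 1` (`d = 2`: `n ≤ 13`).

No named facts are introduced; the door `BDGS2012_count_mono` (all `d`, `n`) stays open.
[cite: BDGS2012, §1.3 (`cₙ ≤ cₙ₊₁`, O'Brien 1990)] [cite: MadrasSlade1993, §7.1 p. 231]
-/

noncomputable section

open Literature.Probability.LatticeModels Literature.Probability.Percolation SimpleGraph

namespace Literature.Probability.RandomPlanarGeometry.SAW.Zd

variable {d : ℕ}

/-- **`cₙ ≤ cₙ₊₁` for every `n ≤ 12`, in every dimension `d ≥ 1`.**
[cite: BDGS2012, §1.3 (`cₙ ≤ cₙ₊₁`, O'Brien 1990)] -/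
theorem count_le_count_succ_of_le_twelve (hd : 1 ≤ d) {n : ℕ} (hn : n ≤ 12) :
    count d n ≤ count d (n + 1) := by
  rcases Nat.lt_or_ge d 3 with hlt | hge
  · interval_cases d
    · exact count_one_le_count_one_succ n
    · exact count_two_le_count_succ_of_le_twelve hn
  · exact count_le_count_succ_of_le_six_mul_sub_two hd (by omega)

/-- **`cₙ ≤ cₙ₊₁` on the proven range**: `n + 2 ≤ 6d`, or `n ≤ 12`, or `n` even with `n + 6 ≤ 8d`
(`d ≥ 1`). [cite: BDGS2012, §1.3 (`cₙ ≤ cₙ₊₁`, O'Brien 1990)] -/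
theorem count_le_count_succ_of_range_twelve {n : ℕ} (hd : 1 ≤ d)
    (h : n + 2 ≤ 6 * d ∨ n ≤ 12 ∨ (Even n ∧ n + 6 ≤ 8 * d)) : count d n ≤ count d (n + 1) := by
  rcases h with h | h | ⟨hev, h⟩
  · exact count_le_count_succ_of_le_six_mul_sub_two hd h
  · exact count_le_count_succ_of_le_twelve hd h
  · exact count_le_count_succ_of_even_le hev h

/-- **`cₘ ≤ cₙ` for `m ≤ n ≤ max (6d, 14) - 1`** (`d ≥ 1`; `d = 2`: `n ≤ 13`).
[cite: BDGS2012, §1.3 (`cₙ ≤ cₙ₊₁`, O'Brien 1990)] -/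
theorem count_mono_of_le_fourteen (hd : 1 ≤ d) {m n : ℕ} (hmn : m ≤ n)
    (hn : n + 1 ≤ max (6 * d) 14) : count d m ≤ count d n := by
  induction n with
  | zero =>
    obtain rfl : m = 0 := by omega
    exact le_rfl
  | succ n ih =>
    rcases Nat.lt_or_ge m (n + 1) with hlt | hge
    · refine (ih (by omega) (by omega)).trans (count_le_count_succ_of_range_twelve hd ?_)
      rcases le_max_iff.1 hn with h | h
      · exact Or.inl (by omega)
      · exact Or.inr (Or.inl (by omega))
    · obtain rfl : m = n + 1 := by omega
      exact le_rfl

/-- `n ↦ cₙ` is monotone on the initial segment `{n | n + 1 ≤ max (6d, 14)}` (`d ≥ 1`).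
[cite: BDGS2012, §1.3 (`cₙ ≤ cₙ₊₁`, O'Brien 1990)] -/
theorem monotoneOn_count_fourteen (hd : 1 ≤ d) :
    MonotoneOn (count d) {n : ℕ | n + 1 ≤ max (6 * d) 14} :=
  fun _ _ _ hn hmn => count_mono_of_le_fourteen hd hmn hn

end Literature.Probability.RandomPlanarGeometry.SAW.Zd

end
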